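import Summits.CriticalPhenomena.PercolationContinuityZ3.Theorems.Transplant.FKConnectivityAllQAntipodalX2DualDefs
import Summits.CriticalPhenomena.PercolationContinuityZ3.Theorems.Transplant.FKConnectivityAllQAntipodalX2SpineRows
import HarnessLib

/-!
# Connectivity correlation inequalities for `φ_{w,q}` — the dual cross functional, file 2: ROW COMBINATORICS OF WORD DUALITY

Helper file (`--supports stmt-CriticalPhenomena-4575`), FK sub-lane `prim-bschramm-fk-2` (gen 14); builds on p205010 (kernel theorem,
internal audit signed; external expert review pending).  No definitions, no named facts, no sorries; pure list combinatorics.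

* `FK.sRowA_map_dualLetter`, `FK.sRowB_map_dualLetter` — the rows of the dual word are the kind-exchanged rows;
* `FK.lastP_map_other`, `FK.headP_map_other` — last/first letter of a kind-exchanged row versus the flags `lastFlag true` / the automaton `runK`;
* `FK.adjP_true_eq`, `FK.runs_other_identity` (`hP + lastFlag true + #W-runs = 1 + #P-runs`), `FK.adjP_true_add` — the per-row exponent identity;
* `FK.nP_add_two_mul_seriesCount` (`nP w + 2·#series = onesCount w + nP (dual w)`), `FK.onesCount_eq_of_forall₂_flip`, `FK.seriesCount_eq_of_map_fst_eq`,
  `FK.sIsLoser_map_swapLetter`, `FK.sIsWinner_map_swapLetter`, `FK.map_fst_map_dualLetter`, `FK.forall₂_flip_dual`.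
[cite: Grimmett2006, §3.9 (p. 63)]
-/

namespace Summit.CriticalPhenomena.PercolationContinuityZ3.Theorems

namespace FK

open SimpleGraph Literature.Probability.LatticeModels Literature.Probability.Percolation X2Word
open scoped Classical

variable {V : Type*}

/-! ### Rows of the dual word -/

/-- Visibility is invariant under letter duality. [folklore] -/
theorem sVisA_dualLetter (l : SLetter) : sVisA (dualLetter l) = sVisA l := by
  obtain ⟨k, b, bb⟩ := l; cases k <;> cases b <;> rfl

/-- Visibility is invariant under letter duality (row `B`). [folklore] -/
theorem sVisB_dualLetter (l : SLetter) : sVisB (dualLetter l) = sVisB l := by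
  obtain ⟨k, b, bb⟩ := l; cases k <;> cases bb <;> rfl

/-- **Row `A` of the dual word is the kind-exchanged row `A`.** [folklore] -/
theorem sRowA_map_dualLetter (w : List SLetter) : sRowA (w.map dualLetter) = (sRowA w).map Kind.other := by
  induction w with
  | nil => rfl
  | cons l w ih =>
    rw [List.map_cons, sRowA_cons, sRowA_cons, ih, sVisA_dualLetter, List.map_append]
    cases sVisA l <;> simp [dualLetter]

/-- **Row `B` of the dual word is the kind-exchanged row `B`.** [folklore] -/
theorem sRowB_map_dualLetter (w : List SLetter) : sRowB (w.map dualLetter) = (sRowB w).map Kind.other := by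
  induction w with
  | nil => rfl
  | cons l w ih =>
    rw [List.map_cons, sRowB_cons, sRowB_cons, ih, sVisB_dualLetter, List.map_append]
    cases sVisB l <;> simp [dualLetter]

/-! ### First and last letters of kind-exchanged rows -/

/-- The kind-exchanged row ends with a particle iff the row is nonempty and ends with a wall, i.e. iff the flag started at `true` ends `false`. [folklore] -/
theorem lastP_map_other (l : List Kind) : lastP (l.map Kind.other) = !lastFlag true l := by
  induction l with
  | nil => rfl
  | cons a l ih =>
    rw [List.map_cons, lastP_cons, lastFlag_cons]
    cases l with
    | nil => cases a <;> rfl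
    | cons b l' =>
      rw [if_neg (by simp)]
      rw [ih]
      -- `lastFlag` of a nonempty word does not see the initial flag
      rw [lastFlag_of_ne_nil _ (List.cons_ne_nil _ _), lastFlag_of_ne_nil _ (List.cons_ne_nil _ _)]

/-- The kind-exchanged row starts with a particle iff the row starts with a wall, i.e. iff the pair automaton from `S` dies. [folklore] -/
theorem headP_map_other (l : List Kind) : headP (l.map Kind.other) = decide (runK .S l = .D) := by
  cases l with
  | nil => rfl
  | cons a l => cases a <;> rfl

/-! ### The per-row exponent identity -/

/-- Starting the adjacency count inside a run costs one pair iff the row starts with a particle. [folklore] -/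
theorem adjP_true_eq (l : List Kind) : adjP true l = adjP false l + (if headP l then 1 else 0) := by
  cases l with
  | nil => rfl
  | cons a l =>
    cases a
    · simp [adjP, headP]
    · simp [adjP, headP]; omega

/-- Runs of the kind-exchanged row, one letter at a time (nonempty tail). [folklore] -/
theorem runsP_cons_eq (a : Kind) (l : List Kind) :
    runsP (a :: l) = runsP l + (if a = .P ∧ headP l = false then 1 else 0) := by
  have h := runsAux_true_add l
  cases a with
  | W => simp [runsP, runsAux]
  | P =>
    simp only [runsP, runsAux, true_and]
    cases hh : headP l
    · rw [hh] at h; simp at h; simp; omega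
    · rw [hh] at h; simp at h; simp; omega

/-- **`#W-runs + 1{last = P} = #P-runs + 1{first = W}`** for every row word (runs of the two kinds alternate). [folklore] -/
theorem runsW_add_lastP (l : List Kind) :
    runsP (l.map Kind.other) + (if lastP l then 1 else 0) = runsP l + (if headP (l.map Kind.other) then 1 else 0) := by
  induction l with
  | nil => rfl
  | cons a l ih =>
    cases l with
    | nil => cases a <;> rfl
    | cons b l' =>
      have ih' := ih
      rw [List.map_cons, runsP_cons_eq, runsP_cons_eq a (b :: l'), lastP_cons, if_neg (List.cons_ne_nil _ _)]
      rw [List.map_cons] at ih' ⊢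
      simp only [headP_cons] at ih' ⊢
      cases a <;> cases b <;> simp [Kind.other] at ih' ⊢ <;> omega

/-- **`hP + lastFlag true + #W-runs = 1 + #P-runs`** for every row word. [folklore] -/
theorem runs_other_identity (l : List Kind) :
    (if headP l then 1 else 0) + (if lastFlag true l then 1 else 0) + runsP (l.map Kind.other) = 1 + runsP l := by
  have h := runsW_add_lastP l
  cases l with
  | nil => rfl
  | cons a l' =>
    rw [lastFlag_of_ne_nil _ (List.cons_ne_nil _ _)]
    rw [List.map_cons, headP_cons] at h
    rw [List.map_cons, headP_cons]
    by_cases hl : lastP (a :: l') = true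
    · rw [if_pos hl] at h ⊢
      cases a <;> simp [Kind.other] at h ⊢ <;> omega
    · rw [if_neg hl] at h ⊢
      cases a <;> simp [Kind.other] at h ⊢ <;> omega

/-- **The per-row exponent identity**: `adjP true l + 1{lastFlag true l} + #P-runs(kind-exchanged l) = #P(l) + 1`. [folklore] -/
theorem adjP_true_add (l : List Kind) :
    adjP true l + (if lastFlag true l then 1 else 0) + runsP (l.map Kind.other) = l.count .P + 1 := by
  have h1 := adjP_true_eq l
  have h2 := adjP_add_runsP l
  have h3 := runs_other_identity l
  omega

/-! ### Word-level bookkeeping -/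

/-- **`nP w + 2·#series letters = onesCount w + nP (dual w)`** (letter by letter). [folklore] -/
theorem nP_add_two_mul_seriesCount (w : List SLetter) :
    nP w + 2 * seriesCount w = onesCount w + nP (w.map dualLetter) := by
  induction w with
  | nil => rfl
  | cons l w ih =>
    rw [List.map_cons, nP_cons, nP_cons, seriesCount_cons, onesCount_cons]
    obtain ⟨k, b, bb⟩ := l
    cases k <;> cases b <;> cases bb <;> simp [sVisA, sVisB, dualLetter, Kind.other] <;> omega

/-- Flips keep the number of `1`-bits. [folklore] -/
theorem onesCount_eq_of_forall₂_flip {w w' : List SLetter}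
    (h : List.Forall₂ (fun a b : SLetter => b = a ∨ (a.2 = (false, true) ∧ b = (a.1, true, false))) w w') :
    onesCount w' = onesCount w := by
  induction h with
  | nil => rfl
  | @cons a b w w' hab _ ih =>
    rw [onesCount_cons, onesCount_cons, ih]
    rcases hab with rfl | ⟨ha, rfl⟩
    · rfl
    · obtain ⟨k, x, y⟩ := a
      simp only [Prod.mk.injEq] at ha
      obtain ⟨rfl, rfl⟩ := ha
      simp

/-- The number of series letters only depends on the kind sequence. [folklore] -/
theorem seriesCount_eq_of_map_fst_eq {w w' : List SLetter} (h : w'.map (·.1) = w.map (·.1)) : seriesCount w' = seriesCount w := by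
  unfold seriesCount
  have e : ∀ u : List SLetter, (u.map fun l : SLetter => if l.1 = Kind.W then 1 else 0) =
      (u.map (·.1)).map fun k => if k = Kind.W then 1 else 0 := fun u => by rw [List.map_map]; rfl
  rw [e, e, h]

/-- The kind sequence of the dual word. [folklore] -/
theorem map_fst_map_dualLetter (w : List SLetter) : (w.map dualLetter).map (·.1) = (w.map (·.1)).map Kind.other := by
  rw [List.map_map, List.map_map]; rfl

/-- Row exchange turns winners into losers … [folklore] -/
theorem sIsLoser_map_swapLetter (w : List SLetter) : sIsLoser (w.map swapLetter) = sIsWinner w := by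
  unfold sIsLoser sIsWinner
  rw [sRowA_map_swapLetter, sRowB_map_swapLetter]
  cases headP (sRowA w) <;> cases lastP (sRowA w) <;> cases headP (sRowB w) <;> cases lastP (sRowB w) <;> rfl

/-- … and losers into winners. [folklore] -/
theorem sIsWinner_map_swapLetter (w : List SLetter) : sIsWinner (w.map swapLetter) = sIsLoser w := by
  unfold sIsLoser sIsWinner
  rw [sRowA_map_swapLetter, sRowB_map_swapLetter]
  cases headP (sRowA w) <;> cases lastP (sRowA w) <;> cases headP (sRowB w) <;> cases lastP (sRowB w) <;> rfl

/-- **Transport of a word-Hall flip through duality**: if `v'` arises from `dual w` by flips `01 → 10`, then `w` arises from `dual v'` by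
flips `01 → 10`. [folklore] -/
theorem forall₂_flip_dual {w v' : List SLetter}
    (h : List.Forall₂ (fun a b : SLetter => b = a ∨ (a.2 = (false, true) ∧ b = (a.1, true, false))) (w.map dualLetter) v') :
    List.Forall₂ (fun a b : SLetter => b = a ∨ (a.2 = (false, true) ∧ b = (a.1, true, false))) (v'.map dualLetter) w := by
  induction w generalizing v' with
  | nil => cases h; exact List.Forall₂.nil
  | cons l w ih =>
    rw [List.map_cons] at h
    cases h with
    | @cons a b u bs hab hrest =>
      rw [List.map_cons]
      refine List.Forall₂.cons ?_ (ih hrest)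
      rcases hab with rfl | ⟨ha, rfl⟩
      · exact Or.inl (dualLetter_dualLetter l).symm
      · right
        obtain ⟨k, x, y⟩ := l
        simp only [dualLetter, Prod.mk.injEq, Bool.not_eq_false', Bool.not_eq_true'] at ha
        obtain ⟨rfl, rfl⟩ := ha
        simp [dualLetter]

end FK

end Summit.CriticalPhenomena.PercolationContinuityZ3.Theorems
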